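import Mathlib
import Summits.NavierStokesRegularity.FluidComputer.AbcInertiaBases
import Summits.NavierStokesRegularity.FluidComputer.AbcInertiaRows
import Summits.NavierStokesRegularity.FluidComputer.AbcClassIIEigenpairRow3002CClassical

/-!
# INERTIA-3L, CLASS II — «EXACTLY ONE», TIGHT FORM: at `R = 300` the unique classical class-II eigenvalue with
# `Re z ≥ 1/5` lies within `Row3002C.rho = 5.1·10⁻¹²` of `Row3002C.lamRe = 0.2617112187526`
# (instab3 g9, cell `ns-blowup`, 2026-08-27)

HONEST FRAMING (human rulings D-0035/D-0074): **MODEL linear operator, computer-assisted; not NS.** Nothing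
here is a statement about Navier–Stokes regularity or blow-up. Object: the linearisation of forced NS about
`U = abcFlow 1 1 1` on the unit torus at viscosity `1/(2π·300)` (`R = 300` in certifier units), symmetry
class II. bears_on LADDER-NS N1* T6 / profile W3 («λ*_II(300) is THE class-II leader: rightmost, simple»).
WHAT THIS IS NOT: not NS; no certificate re-run; no number or census word moves.

instab3 g8's `AbcInertiaExactlyOne.R300II_exactly_one[_i3]` draws the EXISTENCE half from the X0 bracket
(`[0.2517, 0.2717]`, skew-cut certificate). This file draws it instead from the 3-B-nested T1 row `Row3002C`
in its classical form (cert-3 g9's `AbcClassIIEigenpair.row3002C_classII_eigenpair_of_complex_bases`), so the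
«exactly one» sentence carries the TIGHT enclosure needed to compare the class-II leader with the class-I Hopf
pair (`AbcContestIR300`, the contest-I sentence). The uniqueness half is the INERTIA-3L count in arbitrary real
orthonormal orbit bases (`AbcInertiaBases`), exactly as in g8's file.

* `exactly_one_of_row_of_cell` (§1, generic): ANY cell conclusion «at most ONE classical class-II eigenvalue
  with `Re ≥ a`» + ONE T1-row conclusion «`λ⋆` with `|λ⋆ − ℓ| ≤ ρ`, `Im λ⋆ = 0`, `ℓ − ρ ≤ Re λ⋆`, a classical
  class-II eigenfunction» + `a ≤ ℓ − ρ` ⇒ `σ_p(L|II) ∩ {Re ≥ a} = {λ⋆}` (classical eigenfunctions). Pure logic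
  over `AbcInertiaRows.eq_leader_of_card_le_one`.
* `a_le_row3002C`: `1/5 ≤ Row3002C.lamRe − Row3002C.rho`.
* **`R300II_exactly_one_tight_i3`** / **`R300II_exactly_one_tight_i4`** (§2): END-TO-END with literal hypotheses
  — the T1 row `Row3002C` (implementation C = profile-cert-3, K₀ = 22, K_V = 96, in the certifier's COMPLEX orbit
  bases `wf`, AUDIT-BASIS-ℂ j268037 PASSED) and the INERTIA-3L class-II cell of implementation 1 (`(r_L, r_H) =
  (28, 30)`, cert `cert_I3L_R300_cII_a1-5_rL28_rH30.json` 42d246b366f59d1b, kit j269623) resp. implementation 2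
  (`(28, 29)`, `inertia_cert_R300_cII_rL28_rH29.json`, kit j269943), (R1)(R2) in ANY family `e` of real
  orthonormal orbit bases (the certifiers' own bases modulo AUDIT-BASIS).
  What is NOT kernel: the row's primary interval outputs and (R1)(R2) = the programs' verified arithmetic
  (referee re-runs: ref2 g45 B2/B1 CHECK-ONLY j279261/j279264 for the i3 cell; INERTIA-I4 §7), AUDIT-BASIS.

Mathlib + the three files named; no new definitions; std axioms. [folklore]
-/

noncomputable section

open scoped BigOperators ComplexConjugate InnerProductSpace Matrix
open Finset Matrix MeasureTheory UnitAddTorus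

namespace Summit.NavierStokesRegularity.FluidComputer.AbcInertia

open Literature.Analysis.FunctionSpaces Literature.Analysis.FunctionSpaces.Torus
open Literature.Analysis.FunctionSpaces.EuclideanSpace
open Literature.Analysis.FluidPDE Literature.Analysis.FluidPDE.SteadyLattice
open Summit.NavierStokesRegularity.FluidComputer.AbcClassII
open Summit.NavierStokesRegularity.FluidComputer.CertificateAbcSpectrum

/-! ### §1 The generic composition and the abscissa check -/

/-- **Row + cell ⇒ exactly one.** From any INERTIA-3L class-II cell conclusion `hcell` («at most ONE classical
class-II eigenvalue with `Re ≥ a`»), a T1-row conclusion (an eigenvalue `λ⋆` within `ρ` of `ℓ`, `Im λ⋆ = 0`,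
`ℓ − ρ ≤ Re λ⋆`, with a classical class-II eigenfunction) and `a ≤ ℓ − ρ`: the same `λ⋆` data, and every
classical class-II eigenpair `(z, u)` with `Re z ≥ a` has `z = λ⋆`. -/
theorem exactly_one_of_row_of_cell {ν a ℓ ρ : ℝ} (ha : a ≤ ℓ - ρ)
    (hcell : ∀ {n : ℕ} (z : Fin n → ℂ), Function.Injective z →
      ∀ (u : Fin n → UnitAddTorus (Fin 3) → EuclideanSpace ℂ (Fin 3)),
      (∀ k, Torus.LinNSResolventRel ν (Torus.abcFlow 1 1 1) (2 * Real.pi * z k) (u k) 0) →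
      (∀ k, u k ≠ 0) → (∀ k, IsClassII (mFourierCoeff (u k))) → (∀ k, a ≤ (z k).re) → n ≤ 1)
    (lam : ℂ) (hclose : ‖lam - ((ℓ : ℝ) : ℂ)‖ ≤ ρ) (him : lam.im = 0) (hrelo : ℓ - ρ ≤ lam.re)
    (hone : ∃ u : UnitAddTorus (Fin 3) → EuclideanSpace ℂ (Fin 3),
      Torus.LinNSResolventRel ν (Torus.abcFlow 1 1 1) (2 * Real.pi * lam) u 0 ∧ u ≠ 0 ∧ IsClassII (mFourierCoeff u)) :
    ∃ lam : ℂ, ‖lam - ((ℓ : ℝ) : ℂ)‖ ≤ ρ ∧ lam.im = 0 ∧ ℓ - ρ ≤ lam.re ∧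
      (∃ u : UnitAddTorus (Fin 3) → EuclideanSpace ℂ (Fin 3),
        Torus.LinNSResolventRel ν (Torus.abcFlow 1 1 1) (2 * Real.pi * lam) u 0 ∧ u ≠ 0 ∧ IsClassII (mFourierCoeff u)) ∧
      ∀ (z : ℂ) (u : UnitAddTorus (Fin 3) → EuclideanSpace ℂ (Fin 3)),
        Torus.LinNSResolventRel ν (Torus.abcFlow 1 1 1) (2 * Real.pi * z) u 0 → u ≠ 0 →
          IsClassII (mFourierCoeff u) → a ≤ z.re → z = lam := by
  obtain ⟨ulam, hulam, hulam0, hulamII⟩ := hone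
  have hlamre : a ≤ lam.re := ha.trans hrelo
  refine ⟨lam, hclose, him, hrelo, ⟨ulam, hulam, hulam0, hulamII⟩, fun z u hu hu0 huII hzre => ?_⟩
  exact eq_leader_of_card_le_one (ν := ν) (a := a) (fun z hz u hu hu0 hII hre => hcell z hz u hu hu0 hII hre)
    lam ulam hulam hulam0 hulamII hlamre z u hu hu0 huII hzre

/-- The class-II abscissa of record lies left of the `Row3002C` enclosure: `1/5 ≤ Row3002C.lamRe − Row3002C.rho`
(`0.2 ≤ 0.26171… − 5.1·10⁻¹²`). -/
theorem a_le_row3002C : (1 / 5 : ℝ) ≤ ((Row3002C.lamRe : ℚ) : ℝ) - ((Row3002C.rho : ℚ) : ℝ) := by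
  have h : (1 / 5 : ℚ) ≤ Row3002C.lamRe - Row3002C.rho := by norm_num [Row3002C.lamRe, Row3002C.rho]
  have h' : ((1 / 5 : ℚ) : ℝ) ≤ ((Row3002C.lamRe - Row3002C.rho : ℚ) : ℝ) := by exact_mod_cast h
  push_cast at h'
  linarith

/-! ### §2 The END-TO-END sentences (R 300, class II, tight) -/

section Row

variable (wf : Idx → Fam)
variable (hws : ∀ i : Idx, ∀ k ∉ i.1.1, wf i k = 0)
variable (hwt : ∀ (i : Idx) (k : Fin 3 → ℤ), ∑ j : Fin 3, ((k j : ℤ) : ℂ) * wf i k j = 0)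
variable (hwII : ∀ i : Idx, IsClassII (wf i))
variable (hwon : ∀ (O : Orbit) (a b : Fin (odim O)),
  ∑ k ∈ O.1, (inner ℂ (wf ⟨O, a⟩ k) (wf ⟨O, b⟩ k) : ℂ) = if a = b then 1 else 0)
variable (amc : Idx → Idx → ℂ)
variable (hamc : ∀ i j : Idx, amc i j =
  ∑ k ∈ i.1.1, (inner ℂ (wf i k) (Torus.lerayCoeff k (crossForm 1 1 1 (wf j) k)) : ℂ))
variable (e : ∀ O : Orbit, OrthonormalBasis (Fin (odim O)) ℝ (realSpace O.1))
variable (bf : Idx → Fam)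
variable (hbf : ∀ i : Idx, bf i = extend i.1.1 ((e i.1 i.2 : realSpace i.1.1) : EuclideanSpace ℂ (↥i.1.1 × Fin 3)))
variable (am : Idx → Idx → ℝ)
variable (ham : ∀ i j : Idx, am i j =
  (∑ k ∈ i.1.1, (inner ℂ (bf i k) (Torus.lerayCoeff k (crossForm 1 1 1 (bf j) k)) : ℂ)).re)

include hws hwt hwII hwon hamc hbf ham in
/-- **R = 300, CLASS II: EXACTLY ONE, TIGHT — IMPLEMENTATION 1's INERTIA cell.** The T1 row `Row3002C` (implementation C, in the
complex orbit bases `wf`; hypotheses VERBATIM those of `AbcClassIIEigenpair.row3002C_classII_eigenpair_of_complex_bases`)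
AND the INERTIA-3L class-II cell `(300, II, 1/5, 1; 28, 30)` ((R1)(R2) in the real orthonormal orbit bases `e`,
first-order matrix `am`, VERBATIM the shape of `AbcInertiaBases.card_classII_eigenfunctions_le_of_inertia_certificate_of_bases`;
cell of `AbcInertiaRows.R300II_rL28_rH30_card_le_one` / `AbcInertiaExactlyOne.R300II_exactly_one_i3`) IMPLY: there is `λ⋆` with `|λ⋆ − Row3002C.lamRe| ≤ Row3002C.rho` (`5.1·10⁻¹²`), `Im λ⋆ = 0`,
`Row3002C.lamRe − Row3002C.rho ≤ Re λ⋆`, a classical CLASS-II eigenfunction at `λ⋆`, and EVERY classical class-II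
eigenpair `(z, u)` with `Re z ≥ 1/5` has `z = λ⋆`. MODEL; conditional on the two certifier audits and AUDIT-BASIS. -/
theorem R300II_exactly_one_tight_i3
    (vt : Idx → ℂ) (hvt0 : ∀ i, i ∉ cubeIdx 96 → vt i = 0)
    (hres : ∑ i ∈ cubeIdx 96 ∪ (cubeIdx 96).biUnion nbrIdx,
      ‖(if i ∈ cubeIdx 96 then ((((Row3002C.lamRe : ℚ) : ℝ) : ℂ) - ((-(onormSq i.1 / 300) : ℝ) : ℂ)) * vt i
          else 0) - ∑ j ∈ cubeIdx 96, amc i j * vt j‖ ^ 2 ≤ ((Row3002C.rnorm : ℚ) : ℝ) ^ 2)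
    (hntb : ∑ i ∈ cubeIdx 96 \ cubeIdx 22, ‖vt i‖ ^ 2 ≤
      (((5848008621608657 : ℚ) / 576460752303423488 : ℚ) : ℝ) ^ 2)
    (Binv : ((↥(cubeIdx 22) → ℂ) × ℂ) →ₗ[ℂ] ((↥(cubeIdx 22) → ℂ) × ℂ))
    (hBinv : ∀ (c : ↥(cubeIdx 22) → ℂ) (m : ℂ),
      Binv (fun i : ↥(cubeIdx 22) =>
          ((((Row3002C.lamRe : ℚ) : ℝ) : ℂ) - ((-(onormSq i.1.1 / 300) : ℝ) : ℂ)) * c i -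
          ∑ j : ↥(cubeIdx 22), amc i j * c j + m * vt i,
        ∑ i : ↥(cubeIdx 22), conj (vt i) * c i) = (c, m))
    (hαM : ∀ (c : ↥(cubeIdx 22) → ℂ) (g : ℂ),
      ∑ j : ↥(cubeIdx 22), ‖(Binv (c, g)).1 j‖ ^ 2 + ‖(Binv (c, g)).2‖ ^ 2 ≤
        ((Row3002C.alpha0 : ℚ) : ℝ) ^ 2 * (∑ i : ↥(cubeIdx 22), ‖c i‖ ^ 2 + ‖g‖ ^ 2))
    (hβBM : ∀ w : Idx → ℂ,
      ∑ j : ↥(cubeIdx 22), ‖(Binv (fun i : ↥(cubeIdx 22) => -∑ j ∈ nbrIdx i \ cubeIdx 22,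
          amc i j * w j, 0)).1 j‖ ^ 2 +
        ‖(Binv (fun i : ↥(cubeIdx 22) => -∑ j ∈ nbrIdx i \ cubeIdx 22,
          amc i j * w j, 0)).2‖ ^ 2 ≤
        ((Row3002C.betaB : ℚ) : ℝ) ^ 2 * ∑ j ∈ (cubeIdx 22).biUnion nbrIdx \ cubeIdx 22, ‖w j‖ ^ 2)
    (hβCM : ∀ (c : ↥(cubeIdx 22) → ℂ) (g : ℂ),
      ∑ i ∈ ((cubeIdx 22).biUnion nbrIdx ∪ cubeIdx 96) \ cubeIdx 22,
        ‖-∑ j : ↥(cubeIdx 22), amc i j * (Binv (c, g)).1 j +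
          (Binv (c, g)).2 * vt i‖ ^ 2 ≤
        ((Row3002C.betaC : ℚ) : ℝ) ^ 2 * (∑ i : ↥(cubeIdx 22), ‖c i‖ ^ 2 + ‖g‖ ^ 2))
    (hgBM : ∀ w : Idx → ℂ,
      ‖(Binv (fun i : ↥(cubeIdx 22) => ∑ j ∈ nbrIdx i \ cubeIdx 22,
          amc i j * w j, 0)).2‖ ^ 2 ≤
        (((959475027496217 : ℚ) / 281474976710656 : ℚ) : ℝ) ^ 2 *
          ∑ j ∈ (cubeIdx 22).biUnion nbrIdx \ cubeIdx 22, ‖w j‖ ^ 2)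
    (hshellM : ∀ w : Idx → ℂ, (∀ i ∈ cubeIdx 22, w i = 0) →
      (((5501868957119981 : ℚ) / 9007199254740992 : ℚ) : ℝ) * ∑ i ∈ cubeIdx (22 + 1) \ cubeIdx 22, ‖w i‖ ^ 2 ≤
        ∑ i ∈ cubeIdx (22 + 1) \ cubeIdx 22,
          ((((Row3002C.lamRe : ℚ) : ℝ) : ℂ).re - (-(onormSq i.1 / 300)) - Real.sqrt 2) * ‖w i‖ ^ 2 -
        RCLike.re (∑ i ∈ (cubeIdx 22).biUnion nbrIdx \ cubeIdx 22,
          conj (∑ j : ↥(cubeIdx 22), amc i j *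
            (Binv (fun i : ↥(cubeIdx 22) => ∑ j ∈ nbrIdx i \ cubeIdx 22,
              amc i j * w j, 0)).1 j) * w i))
    {HL HH HB : Finset Idx}
    (hHL : ∀ i : Idx, i ∈ HL ↔ onormSq i.1 ≤ (28 : ℝ) ^ 2)
    (hHH : ∀ i : Idx, i ∈ HH ↔ onormSq i.1 ≤ (30 : ℝ) ^ 2)
    (hHB : ∀ i : Idx, i ∈ HB ↔ (30 : ℝ) ^ 2 < onormSq i.1 ∧ onormSq i.1 ≤ ((30 : ℝ) + 1) ^ 2)
    (GH' Ah' : Matrix ↥HH ↥HH ℝ) (AHB' : Matrix ↥HH ↥HB ℝ) (ABH' : Matrix ↥HB ↥HH ℝ) (E : ↥HB → ℝ)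
    (V' : Matrix ↥HH (Fin 1) ℝ) (hGH' : GH'ᵀ = GH')
    (hAh' : Ah' = Matrix.of fun i j : ↥HH =>
      (if i = j then -(onormSq i.1.1 / (300 : ℝ)) - (1 / 5 : ℝ) else 0) + am i.1 j.1)
    (hAHB' : AHB' = Matrix.of fun (i : ↥HH) (l : ↥HB) => am i.1 l.1)
    (hABH' : ABH' = Matrix.of fun (l : ↥HB) (i : ↥HH) => am l.1 i.1)
    (hE : E = fun l : ↥HB => onormSq l.1.1 / (300 : ℝ) + (1 / 5 : ℝ) - Real.sqrt 2)
    (hR1' : ∀ x : ↥HH → ℝ, x ≠ 0 →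
      x ⬝ᵥ ((GH' * Ah' + Ah'ᵀ * GH' + (1 / 2 : ℝ) • ((GH' * AHB' + ABH'ᵀ) * Matrix.diagonal (fun l => (E l)⁻¹) *
        (GH' * AHB' + ABH'ᵀ)ᵀ)) *ᵥ x) < 0)
    (hR2' : ∀ x : ↥HH → ℝ, 0 ≤ x ⬝ᵥ ((GH' + V' * V'ᵀ) *ᵥ x)) :
    ∃ lam : ℂ, ‖lam - (((Row3002C.lamRe : ℚ) : ℝ) : ℂ)‖ ≤ ((Row3002C.rho : ℚ) : ℝ) ∧ lam.im = 0 ∧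
      ((Row3002C.lamRe : ℚ) : ℝ) - ((Row3002C.rho : ℚ) : ℝ) ≤ lam.re ∧
      (∃ u : UnitAddTorus (Fin 3) → EuclideanSpace ℂ (Fin 3),
        Torus.LinNSResolventRel (1 / (2 * Real.pi * 300)) (Torus.abcFlow 1 1 1) (2 * Real.pi * lam) u 0 ∧
          u ≠ 0 ∧ IsClassII (mFourierCoeff u)) ∧
      ∀ (z : ℂ) (u : UnitAddTorus (Fin 3) → EuclideanSpace ℂ (Fin 3)),
        Torus.LinNSResolventRel (1 / (2 * Real.pi * 300)) (Torus.abcFlow 1 1 1) (2 * Real.pi * z) u 0 → u ≠ 0 →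
          IsClassII (mFourierCoeff u) → (1 / 5 : ℝ) ≤ z.re → z = lam := by
  obtain ⟨lam, hclose, him, hrelo, -, hone, -, -⟩ :=
    AbcClassIIEigenpair.row3002C_classII_eigenpair_of_complex_bases wf hws hwt hwII hwon amc hamc vt hvt0 hres hntb
      Binv hBinv hαM hβBM hβCM hgBM hshellM
  exact exactly_one_of_row_of_cell (a := 1 / 5) a_le_row3002C
    (fun z hz u hu hu0 hII hre =>
      card_classII_eigenfunctions_le_of_inertia_certificate_of_bases e bf hbf am ham (R := 300) (a := 1 / 5)
        (rL := 28) (rH := 30) (m := 1) (by norm_num) (by norm_num) (by norm_num) hHL hHH hHB GH' Ah' AHB' ABH' E V'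
        hGH' hAh' hAHB' hABH' hE hR1' hR2' R3_300_30 z hz u hu hu0 hII hre)
    lam hclose him hrelo hone

include hws hwt hwII hwon hamc hbf ham in
/-- **R = 300, CLASS II: EXACTLY ONE, TIGHT — IMPLEMENTATION 2's INERTIA cell.** The T1 row `Row3002C` (implementation C, in the
complex orbit bases `wf`; hypotheses VERBATIM those of `AbcClassIIEigenpair.row3002C_classII_eigenpair_of_complex_bases`)
AND the INERTIA-3L class-II cell `(300, II, 1/5, 1; 28, 29)` ((R1)(R2) in the real orthonormal orbit bases `e`,
first-order matrix `am`, VERBATIM the shape of `AbcInertiaBases.card_classII_eigenfunctions_le_of_inertia_certificate_of_bases`;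
cell of `AbcInertiaRows.R300II_rL28_rH29_card_le_one` / `AbcInertiaExactlyOne.R300II_exactly_one`) IMPLY: there is `λ⋆` with `|λ⋆ − Row3002C.lamRe| ≤ Row3002C.rho` (`5.1·10⁻¹²`), `Im λ⋆ = 0`,
`Row3002C.lamRe − Row3002C.rho ≤ Re λ⋆`, a classical CLASS-II eigenfunction at `λ⋆`, and EVERY classical class-II
eigenpair `(z, u)` with `Re z ≥ 1/5` has `z = λ⋆`. MODEL; conditional on the two certifier audits and AUDIT-BASIS. -/
theorem R300II_exactly_one_tight_i4
    (vt : Idx → ℂ) (hvt0 : ∀ i, i ∉ cubeIdx 96 → vt i = 0)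
    (hres : ∑ i ∈ cubeIdx 96 ∪ (cubeIdx 96).biUnion nbrIdx,
      ‖(if i ∈ cubeIdx 96 then ((((Row3002C.lamRe : ℚ) : ℝ) : ℂ) - ((-(onormSq i.1 / 300) : ℝ) : ℂ)) * vt i
          else 0) - ∑ j ∈ cubeIdx 96, amc i j * vt j‖ ^ 2 ≤ ((Row3002C.rnorm : ℚ) : ℝ) ^ 2)
    (hntb : ∑ i ∈ cubeIdx 96 \ cubeIdx 22, ‖vt i‖ ^ 2 ≤
      (((5848008621608657 : ℚ) / 576460752303423488 : ℚ) : ℝ) ^ 2)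
    (Binv : ((↥(cubeIdx 22) → ℂ) × ℂ) →ₗ[ℂ] ((↥(cubeIdx 22) → ℂ) × ℂ))
    (hBinv : ∀ (c : ↥(cubeIdx 22) → ℂ) (m : ℂ),
      Binv (fun i : ↥(cubeIdx 22) =>
          ((((Row3002C.lamRe : ℚ) : ℝ) : ℂ) - ((-(onormSq i.1.1 / 300) : ℝ) : ℂ)) * c i -
          ∑ j : ↥(cubeIdx 22), amc i j * c j + m * vt i,
        ∑ i : ↥(cubeIdx 22), conj (vt i) * c i) = (c, m))
    (hαM : ∀ (c : ↥(cubeIdx 22) → ℂ) (g : ℂ),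
      ∑ j : ↥(cubeIdx 22), ‖(Binv (c, g)).1 j‖ ^ 2 + ‖(Binv (c, g)).2‖ ^ 2 ≤
        ((Row3002C.alpha0 : ℚ) : ℝ) ^ 2 * (∑ i : ↥(cubeIdx 22), ‖c i‖ ^ 2 + ‖g‖ ^ 2))
    (hβBM : ∀ w : Idx → ℂ,
      ∑ j : ↥(cubeIdx 22), ‖(Binv (fun i : ↥(cubeIdx 22) => -∑ j ∈ nbrIdx i \ cubeIdx 22,
          amc i j * w j, 0)).1 j‖ ^ 2 +
        ‖(Binv (fun i : ↥(cubeIdx 22) => -∑ j ∈ nbrIdx i \ cubeIdx 22,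
          amc i j * w j, 0)).2‖ ^ 2 ≤
        ((Row3002C.betaB : ℚ) : ℝ) ^ 2 * ∑ j ∈ (cubeIdx 22).biUnion nbrIdx \ cubeIdx 22, ‖w j‖ ^ 2)
    (hβCM : ∀ (c : ↥(cubeIdx 22) → ℂ) (g : ℂ),
      ∑ i ∈ ((cubeIdx 22).biUnion nbrIdx ∪ cubeIdx 96) \ cubeIdx 22,
        ‖-∑ j : ↥(cubeIdx 22), amc i j * (Binv (c, g)).1 j +
          (Binv (c, g)).2 * vt i‖ ^ 2 ≤
        ((Row3002C.betaC : ℚ) : ℝ) ^ 2 * (∑ i : ↥(cubeIdx 22), ‖c i‖ ^ 2 + ‖g‖ ^ 2))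
    (hgBM : ∀ w : Idx → ℂ,
      ‖(Binv (fun i : ↥(cubeIdx 22) => ∑ j ∈ nbrIdx i \ cubeIdx 22,
          amc i j * w j, 0)).2‖ ^ 2 ≤
        (((959475027496217 : ℚ) / 281474976710656 : ℚ) : ℝ) ^ 2 *
          ∑ j ∈ (cubeIdx 22).biUnion nbrIdx \ cubeIdx 22, ‖w j‖ ^ 2)
    (hshellM : ∀ w : Idx → ℂ, (∀ i ∈ cubeIdx 22, w i = 0) →
      (((5501868957119981 : ℚ) / 9007199254740992 : ℚ) : ℝ) * ∑ i ∈ cubeIdx (22 + 1) \ cubeIdx 22, ‖w i‖ ^ 2 ≤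
        ∑ i ∈ cubeIdx (22 + 1) \ cubeIdx 22,
          ((((Row3002C.lamRe : ℚ) : ℝ) : ℂ).re - (-(onormSq i.1 / 300)) - Real.sqrt 2) * ‖w i‖ ^ 2 -
        RCLike.re (∑ i ∈ (cubeIdx 22).biUnion nbrIdx \ cubeIdx 22,
          conj (∑ j : ↥(cubeIdx 22), amc i j *
            (Binv (fun i : ↥(cubeIdx 22) => ∑ j ∈ nbrIdx i \ cubeIdx 22,
              amc i j * w j, 0)).1 j) * w i))
    {HL HH HB : Finset Idx}
    (hHL : ∀ i : Idx, i ∈ HL ↔ onormSq i.1 ≤ (28 : ℝ) ^ 2)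
    (hHH : ∀ i : Idx, i ∈ HH ↔ onormSq i.1 ≤ (29 : ℝ) ^ 2)
    (hHB : ∀ i : Idx, i ∈ HB ↔ (29 : ℝ) ^ 2 < onormSq i.1 ∧ onormSq i.1 ≤ ((29 : ℝ) + 1) ^ 2)
    (GH' Ah' : Matrix ↥HH ↥HH ℝ) (AHB' : Matrix ↥HH ↥HB ℝ) (ABH' : Matrix ↥HB ↥HH ℝ) (E : ↥HB → ℝ)
    (V' : Matrix ↥HH (Fin 1) ℝ) (hGH' : GH'ᵀ = GH')
    (hAh' : Ah' = Matrix.of fun i j : ↥HH =>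
      (if i = j then -(onormSq i.1.1 / (300 : ℝ)) - (1 / 5 : ℝ) else 0) + am i.1 j.1)
    (hAHB' : AHB' = Matrix.of fun (i : ↥HH) (l : ↥HB) => am i.1 l.1)
    (hABH' : ABH' = Matrix.of fun (l : ↥HB) (i : ↥HH) => am l.1 i.1)
    (hE : E = fun l : ↥HB => onormSq l.1.1 / (300 : ℝ) + (1 / 5 : ℝ) - Real.sqrt 2)
    (hR1' : ∀ x : ↥HH → ℝ, x ≠ 0 →
      x ⬝ᵥ ((GH' * Ah' + Ah'ᵀ * GH' + (1 / 2 : ℝ) • ((GH' * AHB' + ABH'ᵀ) * Matrix.diagonal (fun l => (E l)⁻¹) *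
        (GH' * AHB' + ABH'ᵀ)ᵀ)) *ᵥ x) < 0)
    (hR2' : ∀ x : ↥HH → ℝ, 0 ≤ x ⬝ᵥ ((GH' + V' * V'ᵀ) *ᵥ x)) :
    ∃ lam : ℂ, ‖lam - (((Row3002C.lamRe : ℚ) : ℝ) : ℂ)‖ ≤ ((Row3002C.rho : ℚ) : ℝ) ∧ lam.im = 0 ∧
      ((Row3002C.lamRe : ℚ) : ℝ) - ((Row3002C.rho : ℚ) : ℝ) ≤ lam.re ∧
      (∃ u : UnitAddTorus (Fin 3) → EuclideanSpace ℂ (Fin 3),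
        Torus.LinNSResolventRel (1 / (2 * Real.pi * 300)) (Torus.abcFlow 1 1 1) (2 * Real.pi * lam) u 0 ∧
          u ≠ 0 ∧ IsClassII (mFourierCoeff u)) ∧
      ∀ (z : ℂ) (u : UnitAddTorus (Fin 3) → EuclideanSpace ℂ (Fin 3)),
        Torus.LinNSResolventRel (1 / (2 * Real.pi * 300)) (Torus.abcFlow 1 1 1) (2 * Real.pi * z) u 0 → u ≠ 0 →
          IsClassII (mFourierCoeff u) → (1 / 5 : ℝ) ≤ z.re → z = lam := by
  obtain ⟨lam, hclose, him, hrelo, -, hone, -, -⟩ :=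
    AbcClassIIEigenpair.row3002C_classII_eigenpair_of_complex_bases wf hws hwt hwII hwon amc hamc vt hvt0 hres hntb
      Binv hBinv hαM hβBM hβCM hgBM hshellM
  exact exactly_one_of_row_of_cell (a := 1 / 5) a_le_row3002C
    (fun z hz u hu hu0 hII hre =>
      card_classII_eigenfunctions_le_of_inertia_certificate_of_bases e bf hbf am ham (R := 300) (a := 1 / 5)
        (rL := 28) (rH := 29) (m := 1) (by norm_num) (by norm_num) (by norm_num) hHL hHH hHB GH' Ah' AHB' ABH' E V'
        hGH' hAh' hAHB' hABH' hE hR1' hR2' R3_300_29 z hz u hu hu0 hII hre)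
    lam hclose him hrelo hone

end Row

end Summit.NavierStokesRegularity.FluidComputer.AbcInertia

end
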